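import Summits.HodgeConjecture.CorCM.CycleClassFacts
import Literature.AlgebraicGeometry.ComplexMultiplication.ShimuraInflationBettiJunctions
import Literature.AlgebraicGeometry.Milne1999.CMHodgeHypothesisFromCMTypedProducts
import HarnessLib

/-!
# COR-CM model layer, part 4: the antilinear isogeny between conjugate CM types (`Fact_conjIsogeny`)
# on the Picard–CM model universe

Cell `pub-hodgecm2` (COR-CM), seat `model-1`; row M21 of `BINDER-OWNERS.md` = stage-1 `ModelAxioms` field 25
`Fact_conjIsogeny` (`HodgeCM/Geometry/Facts.lean` l.194, FACTS.md §1 M25; READ by rfwf Prop 2.2,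
`Proofs/Prop22/Dictionary`):

  if `Φ′ = Φ̄` then there is a morphism `u : A_{(K,Φ)} → A_{(K,Φ′)}` with `u^*` bijective on `H¹(−, ℚ)` and
  `u^* ∘ ι_{Φ′}(a) = ι_Φ(ā) ∘ u^*` for all `a ∈ K`.

On the model the two varieties are the CHOSEN realisations (record (iii) `PicardCM.CMAbelianVarietyRealised`) of two
codes `⟨E, Ψ⟩`, `⟨E, Ψ′⟩` over ONE subfield `E ⊂ ℂ` with `Ψ′ = Ψ̄`; nothing relates two independent choices except
Shimura's «any two abelian varieties of the same CM-type are isogenous» — the tree's cited record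
`ComplexMultiplication.Shimura1998_Thm2_Cor` (Shimura 1998 §6.1, Corollary of Theorem 2 with the Remark), taken here as
the explicit hypothesis `hcor` (the same binder as model-2's `cmDominated` row M20).  PROOF (`var_conjIsogeny`):
the realisation `(A, ι, θ)` of `⟨E, Ψ⟩`, with its action twisted by complex conjugation
(`IsCMTypeRealisation.transport` along `κ_E⁻¹`, `κ_E = e ∘ κ ∘ e⁻¹` the conjugation of `E` induced from an abstract
`κ : K ≃+* K` that every complex embedding intertwines with `conj`), is a realisation of type `Ψ̄ = Ψ′`; the Corollary
and the kernel theorem `isogeny_bettiMap_bijective_holds` (`exists_bettiMap_bijective_equivariant`) give `g : A → A′`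
with `g^*` bijective on `H¹(−, ℚ)` and `g^* ∘ ι′(a)^* = ι(κ_E a)^* ∘ g^*` for `a ∈ 𝓞_E`; the rational CM actions
`BettiUniverse.cmAction` of the model agree with these pull-backs on `𝓞_K` (`pull_eq_cmAction`) and both sides are
`ℚ`-linear in `a`, so the identity extends from the integral basis to `K` (`Module.Basis.ext`).
-/

noncomputable section

open scoped TensorProduct
open CategoryTheory
open NumberField
open Literature.AlgebraicTopology.SingularHomology
open Literature.AlgebraicGeometry.Motives (SchemeOver ComplexPoints IsSmoothProjective bettiCohomology AbelianVariety CMType)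
open Literature.AlgebraicGeometry.HodgeTheory
open Literature.AlgebraicGeometry.ComplexMultiplication
open Literature.NumberTheory.Automorphic.PicardCM

namespace Summit.HodgeConjecture.CorCM.Model

/-! ### The rational CM action at elements whose complexified action is induced by a morphism -/

/-- If `f : A → A` induces `θ(k)` on `H¹(A(ℂ); ℂ)` then its rational pull-back IS `cmAction θ _ k` (both have the same
complexification; the rational lattice is injective). -/
theorem pull_eq_cmAction {g : ℕ} {A : SchemeOver ℂ} {K : Type} [Field K] [NumberField K]
    (θ : K →+* Module.End ℂ (complexBetti A 1)) (hθ : BettiUniverse.IsInducedOnIntegers θ)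
    (_hA : IsSmoothProjective g A) {f : A ⟶ A} {k : K} (hf : (complexBetti.map f 1).hom = θ k) :
    BettiUniverse.pull f 1 = BettiUniverse.cmAction θ hθ k := by
  refine LinearMap.ext fun v ↦ ofRatClass_injective 1 ?_
  rw [ofRatClass_pull, BettiUniverse.ofRatClass_cmAction, ← hf]

/-! ### Conjugation transported to the code field -/

section Conj

variable {K : Type} [Field K] (E : Subfield ℂ) (e : K ≃+* E) (κ : K ≃+* K)

/-- For `κ : K ≃+* K` intertwined with complex conjugation by every complex embedding and `e : K ≃+* E ⊂ ℂ`,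
composing a complex embedding `σ` of `E` with `(e ∘ κ ∘ e⁻¹)⁻¹` is the conjugate embedding `σ̄`. -/
theorem comp_conjTransport_symm_eq_conjugate (hκ : ∀ (τ : K →+* ℂ) (x : K), τ (κ x) = starRingEnd ℂ (τ x))
    (σ : (E : Type) →+* ℂ) :
    σ.comp (e.symm.trans (κ.trans e)).symm.toRingHom = NumberField.ComplexEmbedding.conjugate σ := by
  refine RingHom.ext fun x ↦ ?_
  have h := hκ (σ.comp e.toRingHom) (κ.symm (e.symm x))
  rw [RingEquiv.apply_symm_apply] at h
  change σ (e (κ.symm (e.symm x))) = starRingEnd ℂ (σ x)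
  have h' : σ (e (e.symm x)) = starRingEnd ℂ (σ (e (κ.symm (e.symm x)))) := h
  rw [RingEquiv.apply_symm_apply] at h'
  rw [h', starRingEnd_self_apply]

end Conj

/-! ### `Fact_conjIsogeny` on `PicardCM.Var` -/

section PicardCMVar

/-- **`Fact_conjIsogeny` of the model universe `universeOf hHD hI hU h₃`**, under Shimura's Corollary `hcor`:
for two codes `⟨E, Ψ⟩`, `⟨E, Ψ′⟩` over one subfield `E ⊂ ℂ` with `Ψ′ = Ψ̄` (`hΨ`), an abstract field `K` with
`e : K ≃+* E` (the package: `K` a CM field, `E = (cmEmb K)(K)`, `e = cmCodeEquiv K Φ`, `Ψ = (cmCode K Φ).Φ`) and a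
conjugation `κ` of `K` (`hκ`: every complex embedding intertwines it with `conj`; the package:
`(IsCMField.complexConj K).toRingEquiv`), there is a morphism `u` between the realised varieties with `u^*` bijective
on `H¹(−; ℚ)` and `u^* ∘ ι′(a) = ι(κ a) ∘ u^*` for the model's rational CM actions, all `a ∈ K`. -/
theorem var_conjIsogeny (hHD : exists_isReal_hodgeModel) (hI : hodgePQ_independent_of_hodgeModel)
    (hU : BallQuotientUniformisedDatum) (h₃ : CMAbelianVarietyRealised) (hcor : Shimura1998_Thm2_Cor)
    (E : Subfield ℂ) [NumberField E] [IsCMField E] (Ψ Ψ' : CMType E)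
    {K : Type} [Field K] [NumberField K] (e : K ≃+* E) (κ : K ≃+* K)
    (hκ : ∀ (τ : K →+* ℂ) (x : K), τ (κ x) = starRingEnd ℂ (τ x))
    (hΨ : ∀ σ : (E : Type) →+* ℂ, σ ∈ Ψ'.1 ↔ NumberField.ComplexEmbedding.conjugate σ ∈ Ψ.1) :
    ∃ u : Var.Mor hU h₃ (.cm ⟨E, Ψ⟩) (.cm ⟨E, Ψ'⟩),
      Function.Bijective (BettiUniverse.pull u 1) ∧
      ∀ a : K, BettiUniverse.pull u 1 ∘ₗ
          (BettiUniverse.cmEndAction ((cmRealisation h₃ ⟨E, Ψ'⟩).θ.comp e.toRingHom)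
            ((cmRealisation h₃ ⟨E, Ψ'⟩).exists_map_comp e) hHD hI
            (Var.isSmoothProjective hU h₃ (.cm ⟨E, Ψ'⟩))).ι a =
        (BettiUniverse.cmEndAction ((cmRealisation h₃ ⟨E, Ψ⟩).θ.comp e.toRingHom)
            ((cmRealisation h₃ ⟨E, Ψ⟩).exists_map_comp e) hHD hI
            (Var.isSmoothProjective hU h₃ (.cm ⟨E, Ψ⟩))).ι (κ a) ∘ₗ BettiUniverse.pull u 1 := by
  set R := cmRealisation h₃ ⟨E, Ψ⟩ with hR
  set R' := cmRealisation h₃ ⟨E, Ψ'⟩ with hR'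
  -- the conjugation of `E` induced from `κ`, and `Ψ' = Ψ` transported along its inverse
  let κE : (E : Type) ≃+* E := e.symm.trans (κ.trans e)
  have hΨ' : CMCode.cmTypeMap κE.symm Ψ = Ψ' := by
    refine Subtype.ext (Set.ext fun σ ↦ ?_)
    change σ.comp κE.symm.toRingHom ∈ Ψ.1 ↔ σ ∈ Ψ'.1
    rw [comp_conjTransport_symm_eq_conjugate E e κ hκ σ, hΨ σ]
  -- the twisted realisation of `⟨E, Ψ⟩` is a realisation of `Ψ'`
  have h : IsCMTypeRealisation Ψ R.AV R.ι R.θ := Literature.AlgebraicGeometry.Milne1999.cmRealisation_isCMTypeRealisation h₃ ⟨E, Ψ⟩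
  have htw := h.transport κE.symm
  rw [hΨ', RingEquiv.symm_symm] at htw
  have h' : IsCMTypeRealisation Ψ' R'.AV R'.ι R'.θ := Literature.AlgebraicGeometry.Milne1999.cmRealisation_isCMTypeRealisation h₃ ⟨E, Ψ'⟩
  -- Shimura's Corollary + bijectivity of isogenies on `H¹(ℚ)`
  obtain ⟨g, hbij, hequiv⟩ :=
    exists_bettiMap_bijective_equivariant hcor isogeny_bettiMap_bijective_holds Ψ' htw h'
  refine ⟨g.hom.hom.hom, hbij, ?_⟩
  -- the intertwining, first on the integral basis of `K`
  have hθ := R.exists_map_comp e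
  have hθ' := R'.exists_map_comp e
  have key : ∀ b : 𝓞 K,
      BettiUniverse.pull g.hom.hom.hom 1 ∘ₗ BettiUniverse.cmAction (R'.θ.comp e.toRingHom) hθ' (b : K) =
        BettiUniverse.cmAction (R.θ.comp e.toRingHom) hθ (κ b) ∘ₗ BettiUniverse.pull g.hom.hom.hom 1 := by
    intro b
    -- `ι'(e b)^* = cmAction' b` and `ι(κE (e b))^* = cmAction (κ b)` on `H¹(ℚ)`
    have h1 : BettiUniverse.pull (R'.ι (RingOfIntegers.mapRingEquiv e b)).hom.hom.hom 1 =
        BettiUniverse.cmAction (R'.θ.comp e.toRingHom) hθ' (b : K) :=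
      pull_eq_cmAction _ hθ' R'.isSmoothProjective (by
        rw [R'.map_ι, RingOfIntegers.mapRingEquiv_apply]; rfl)
    have h2 : BettiUniverse.pull (R.ι (RingOfIntegers.mapRingEquiv κE (RingOfIntegers.mapRingEquiv e b))).hom.hom.hom 1 =
        BettiUniverse.cmAction (R.θ.comp e.toRingHom) hθ (κ b) :=
      pull_eq_cmAction _ hθ R.isSmoothProjective (by
        rw [R.map_ι, RingOfIntegers.mapRingEquiv_apply, RingOfIntegers.mapRingEquiv_apply]
        change R.θ (e (κ (e.symm (e (b : K))))) = R.θ (e (κ b))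
        rw [RingEquiv.symm_apply_apply])
    rw [← h1, ← h2]
    exact hequiv (RingOfIntegers.mapRingEquiv e b)
  -- extend `ℚ`-linearly from the integral basis
  intro a
  rw [BettiUniverse.cmEndAction_ι, BettiUniverse.cmEndAction_ι]
  let V := bettiCohomology R.A 1
  let V' := bettiCohomology R'.A 1
  let F₁ : K →ₗ[ℚ] (V' →ₗ[ℚ] V) :=
    { toFun := fun x ↦ BettiUniverse.pull g.hom.hom.hom 1 ∘ₗ BettiUniverse.cmAction (R'.θ.comp e.toRingHom) hθ' x
      map_add' := fun x y ↦ by rw [map_add, LinearMap.comp_add]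
      map_smul' := fun q x ↦ by rw [map_smul, LinearMap.comp_smul, RingHom.id_apply] }
  let F₂ : K →ₗ[ℚ] (V' →ₗ[ℚ] V) :=
    { toFun := fun x ↦ BettiUniverse.cmAction (R.θ.comp e.toRingHom) hθ (κ x) ∘ₗ BettiUniverse.pull g.hom.hom.hom 1
      map_add' := fun x y ↦ by rw [map_add, map_add, LinearMap.add_comp]
      map_smul' := fun q x ↦ by rw [map_rat_smul, map_smul, LinearMap.smul_comp, RingHom.id_apply] }
  have hF : F₁ = F₂ := by
    refine (integralBasis K).ext fun i ↦ ?_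
    rw [integralBasis_apply]
    exact key (RingOfIntegers.basis K i)
  exact LinearMap.congr_fun hF a

end PicardCMVar

end Summit.HodgeConjecture.CorCM.Model

end
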